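import Summits.QuantumFields.YangMills.Theses.LogConcaveChart

/-!
# Assembly of route `LogConcaveChart` (rung R2a `BalabanLadder.NT` of LADDER-YM; ideator seat ym-idea-8 g2, LINE 3)

Proof of the route's `Assembly` item (stmt-QuantumFields-26773, rev 1):
`QuadraticCovarianceComparison → ChartCovarianceTransfer → UnitScaleChart → SkewAtChartUnit → BalabanLadder.NT`.
From `QuadraticCovarianceComparison` take `C, δ₀`; for `G` take `K` from `UnitScaleChart`, put
`δ := min δ₀ (min (1/2) (1/(16·K·(|C|+1)²)))`, obtain the unit `(r, a)`, the mode `v` and the scale `ε`; at every admissible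
`(β, L)` the chart package gives `Q2 = Cov_μ(Af, Ag)`; `ChartCovarianceTransfer` (with `X, Y := Af, Ag`, proxies
`f∘Φ, g∘Φ`, `ηc := ε`, `ηp = ηq := δε`, `sp = sq := √(Kε)`) moves the floor to `Cov_μ(f∘Φ, g∘Φ)` at cost `≤ 2ε`, law
closeness to the log-concave model at cost `ε`, and `QuadraticCovarianceComparison` to the Gaussian value `rC ≥ 8ε` at cost
`|C|·δ·√(rVf·rVg) ≤ ε/16`; hence `Q2 ≥ ε` = clause (i); clause (ii) is `SkewAtChartUnit` at the same unit.
No summit, leg or spine crux is proved here: `NT` stays open behind the open cruxes `UnitScaleChart`,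
`QuadraticCovarianceComparison`, `SkewAtChartUnit` (and the support `ChartCovarianceTransfer`).
-/

set_option autoImplicit false

namespace Summit.QuantumFields.YangMills.Theorems

open MeasureTheory
open Literature.MathematicalPhysics.QuantumFieldTheory Literature.MathematicalPhysics.QuantumLattice
  Literature.Probability.LatticeModels Summit.QuantumFields.YangMills.Cruxes.OSLegsFromFemtoAndGap.DlrCollarTransfer

/-- A quadratic-plus-linear form composed with a bounded measurable chart is square integrable (finite measure). -/
theorem memLp_two_quadForm_comp {Ω : Type} [MeasurableSpace Ω] (μ : Measure Ω) [IsFiniteMeasure μ] {n : ℕ}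
    (Φ : Ω → (Fin n → ℝ)) (hΦ : Measurable Φ) (R : ℝ) (hR : ∀ ω, ‖Φ ω‖ ≤ R)
    (H : Matrix (Fin n) (Fin n) ℝ) (b : Fin n → ℝ) :
    MemLp (fun ω => Φ ω ⬝ᵥ H.mulVec (Φ ω) + b ⬝ᵥ Φ ω) 2 μ := by
  have hF : Continuous fun x : Fin n → ℝ => x ⬝ᵥ H.mulVec x + b ⬝ᵥ x :=
    (continuous_id.dotProduct (continuous_const.matrix_mulVec continuous_id)).add
      (continuous_const.dotProduct continuous_id)
  obtain ⟨Cb, hCb⟩ := (isCompact_closedBall (0 : Fin n → ℝ) R).exists_bound_of_continuousOn hF.continuousOn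
  refine MemLp.of_bound ((hF.measurable.comp hΦ).aestronglyMeasurable) Cb (Filter.Eventually.of_forall fun ω => ?_)
  have hmem : Φ ω ∈ Metric.closedBall (0 : Fin n → ℝ) R := by
    rw [Metric.mem_closedBall, dist_zero_right]; exact hR ω
  exact hCb (Φ ω) hmem

/-- The real arithmetic of the floor: transfer loss `≤ 2ε`, law closeness `ε`, comparison error `≤ ε/16`,
Gaussian floor `rC ≥ 8ε` give `CovA ≥ ε`. -/
theorem floor_arith {ε δ K C CovA Covp Gm rC S : ℝ} (hε : 0 < ε) (hK : 0 < K) (hδ : 0 < δ)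
    (hδhalf : δ ≤ 1 / 2) (hδK : δ * (16 * K * (|C| + 1) ^ 2) ≤ 1) (hS0 : 0 ≤ S) (hS : S ≤ K * ε)
    (hrC : 8 * ε ≤ rC)
    (h1 : |CovA - Covp| ≤ ε + Real.sqrt (δ * ε) * (Real.sqrt (δ * ε) + Real.sqrt (K * ε)) +
      Real.sqrt (K * ε) * Real.sqrt (δ * ε))
    (h2 : |Covp - Gm| ≤ ε) (h3 : |Gm - rC| ≤ C * δ * S) : ε ≤ CovA := by
  have hKε : 0 ≤ K * ε := by positivity
  have hδε : 0 ≤ δ * ε := by positivity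
  have hC1 : (1 : ℝ) ≤ (|C| + 1) ^ 2 := by nlinarith [abs_nonneg C]
  have hCle : |C| ≤ (|C| + 1) ^ 2 := by nlinarith [abs_nonneg C]
  have hδKnn : 0 ≤ δ * K := by positivity
  have hδK16 : δ * K ≤ 1 / 16 := by nlinarith
  have hCδK16 : |C| * (δ * K) ≤ 1 / 16 := by nlinarith [abs_nonneg C]
  have hA1 : Real.sqrt (δ * ε) * Real.sqrt (δ * ε) ≤ ε / 2 := by
    rw [Real.mul_self_sqrt hδε]; nlinarith
  have hA2 : Real.sqrt (δ * ε) * Real.sqrt (K * ε) ≤ ε / 4 := by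
    rw [← Real.sqrt_mul hδε (K * ε)]
    have h1 : δ * ε * (K * ε) ≤ (ε / 4) ^ 2 := by nlinarith [sq_nonneg ε]
    calc Real.sqrt (δ * ε * (K * ε)) ≤ Real.sqrt ((ε / 4) ^ 2) := Real.sqrt_le_sqrt h1
      _ = ε / 4 := Real.sqrt_sq (by positivity)
  have hA3 : Real.sqrt (K * ε) * Real.sqrt (δ * ε) ≤ ε / 4 := by rw [mul_comm]; exact hA2
  have hA4 : C * δ * S ≤ ε / 16 := by
    have g1 : C * δ * S ≤ |C| * δ * S :=
      mul_le_mul_of_nonneg_right (mul_le_mul_of_nonneg_right (le_abs_self C) hδ.le) hS0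
    have g2 : |C| * δ * S ≤ |C| * δ * (K * ε) := mul_le_mul_of_nonneg_left hS (by positivity)
    have g3 : |C| * δ * (K * ε) ≤ ε / 16 := by nlinarith
    linarith
  have hTb : Real.sqrt (δ * ε) * (Real.sqrt (δ * ε) + Real.sqrt (K * ε)) +
      Real.sqrt (K * ε) * Real.sqrt (δ * ε) ≤ ε := by
    rw [mul_add]; linarith
  have e1 := (abs_le.1 h1).1
  have e2 := (abs_le.1 h2).1
  have e3 := (abs_le.1 h3).1
  linarith

set_option maxHeartbeats 800000 in
open Summit.QuantumFields.YangMills.Theses.LogConcaveChart in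
/-- The `Assembly` item of route `LogConcaveChart` (stmt-QuantumFields-26773) holds. -/
theorem logConcaveChart_assembly : Summit.QuantumFields.YangMills.Theses.LogConcaveChart.Assembly := by
  intro hQ hT hU hS G _ _ _ _ hG
  letI : MeasurableSpace G := borel G
  haveI : BorelSpace G := ⟨rfl⟩
  obtain ⟨C, δ₀, hδ₀, hδ₀1, hQ'⟩ := hQ
  obtain ⟨K, hK, hU'⟩ := hU G hG
  set δ : ℝ := min δ₀ (min (1 / 2) (1 / (16 * K * (|C| + 1) ^ 2))) with hδdef
  have hden : 0 < 16 * K * (|C| + 1) ^ 2 := by positivity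
  have hδpos : 0 < δ := lt_min hδ₀ (lt_min (by norm_num) (one_div_pos.2 hden))
  have hδ₀' : δ ≤ δ₀ := min_le_left _ _
  have hδhalf : δ ≤ 1 / 2 := le_trans (min_le_right _ _) (min_le_left _ _)
  have hδK : δ ≤ 1 / (16 * K * (|C| + 1) ^ 2) := le_trans (min_le_right _ _) (min_le_right _ _)
  have hδ1 : δ ≤ 1 := le_trans hδhalf (by norm_num)
  obtain ⟨r, a, ha, hlim, v, ε, β₅, Λ₅, hsupp, hε, hall⟩ := hU' δ hδpos
  refine ⟨r, a, ha, hlim, ?_, ?_⟩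
  · refine ⟨v, ε, β₅, Λ₅, hsupp, hε, ?_⟩
    intro β hβ L hL
    obtain ⟨n, Φ, H₀, Hf, Hg, bf, bg, A, R, Mb, hΦm, hΦR, hAfm, hAgm, hAfb, hAgb, hH₀, hHf, hHg, hA, hsand,
      hcent, hQ2, hlaw, hVf, hVg, hcqf, hcqg, hcdec, hrC, hrVf0, hrVf, hrVg0, hrVg⟩ := hall β hβ L hL
    haveI : NeZero (2 * L + 1) := ⟨by omega⟩
    haveI : IsProbabilityMeasure (wilsonMeasure (d := 4) (L := 2 * L + 1) (G := G) r.ρ β) :=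
      isProbabilityMeasure_wilsonMeasure (d := 4) (L := 2 * L + 1) (G := G) r.ρ r.continuous β
    have hKε : 0 ≤ K * ε := by positivity
    have hδε : 0 ≤ δ * ε := by positivity
    -- square-integrability of the chart proxies `f∘Φ`, `g∘Φ`
    have hp2 := memLp_two_quadForm_comp (wilsonMeasure (d := 4) (L := 2 * L + 1) (G := G) r.ρ β) Φ hΦm R hΦR Hf bf
    have hq2 := memLp_two_quadForm_comp (wilsonMeasure (d := 4) (L := 2 * L + 1) (G := G) r.ρ β) Φ hΦm R hΦR Hg bg
    -- (1) covariance transfer from `Cov(Af, Ag)` to `Cov(f∘Φ, g∘Φ)`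
    have hTr := hT (GaugeConfig 4 (2 * L + 1) G) (wilsonMeasure (d := 4) (L := 2 * L + 1) (G := G) r.ρ β) n Φ
      _ _ _ _ Mb ε (δ * ε) (δ * ε) (Real.sqrt (K * ε)) (Real.sqrt (K * ε)) hΦm hAfm hAgm hAfb hAgb hp2 hq2
      hδε hδε (Real.sqrt_nonneg _) (Real.sqrt_nonneg _) hcdec hcqf hcqg
      (hVf.trans_eq (Real.sq_sqrt hKε).symm) (hVg.trans_eq (Real.sq_sqrt hKε).symm)
    -- (2) the log-concave covariance comparison at tolerance `δ ≤ δ₀`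
    have hq := hQ' δ hδpos.le hδ₀' n H₀ Hf Hg bf bg A hH₀ hHf hHg hA hsand hcent
    dsimp only at hq hlaw hTr
    -- (3) the Gaussian proxy variances bound the comparison error scale
    have hS : Real.sqrt ((2 * (H₀⁻¹ * Hf * H₀⁻¹ * Hf).trace + bf ⬝ᵥ H₀⁻¹.mulVec bf) *
        (2 * (H₀⁻¹ * Hg * H₀⁻¹ * Hg).trace + bg ⬝ᵥ H₀⁻¹.mulVec bg)) ≤ K * ε := by
      calc Real.sqrt ((2 * (H₀⁻¹ * Hf * H₀⁻¹ * Hf).trace + bf ⬝ᵥ H₀⁻¹.mulVec bf) *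
            (2 * (H₀⁻¹ * Hg * H₀⁻¹ * Hg).trace + bg ⬝ᵥ H₀⁻¹.mulVec bg))
          ≤ Real.sqrt (K * ε * (K * ε)) := Real.sqrt_le_sqrt (mul_le_mul hrVf hrVg hrVg0 hKε)
        _ = K * ε := Real.sqrt_mul_self hKε
    -- (4) the floor
    rw [hQ2]
    exact floor_arith hε hK hδpos hδhalf ((le_div_iff₀ hden).1 hδK) (Real.sqrt_nonneg _) hS hrC hTr hlaw hq
  · exact hS G hG r a ha hlim ⟨K, δ, v, ε, β₅, Λ₅, hK, hδpos, hδ1, hsupp, hε, hall⟩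

end Summit.QuantumFields.YangMills.Theorems
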